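import Literature.Probability.Percolation.AnnulusSubcontinuum
import Literature.Probability.Percolation.QuadCrossingRawClosed
import Literature.Probability.Percolation.AnnulusCrossingBoundProofs
import HarnessLib

/-!
# Closing the edges near finitely many points changes a crossing event little (Schramm–Smirnov (4.4))

Topic `Probability/Percolation`; proofs-only support file (no definition, no named fact) for the
mesh-independent gluing Proposition 4.1 of O. Schramm, S. Smirnov, *On the scaling limits of planar
percolation*, Ann. Probab. 39 (2011), arXiv:1101.5820, §4 (p. 17 of the arXiv version):

> "For somewhat technical reasons, it will be convenient to consider in place of `ω` the
> configuration `ω̃` which is modified on the tiles intersecting disks `B(x_j, s)`. We alter `ω` so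
> that for every component `K_i` one of two short sides is covered by open tiles and another by
> closed.  Clearly, (4.3) implies that if `η < s`, `P_η({ω ∈ ⊞_{Q₀}} Δ {ω̃ ∈ ⊞_{Q₀}}) ≤ ε₀`. (4.4)"

where (4.3) is the one-arm smallness `P_η(crossing from B(x_i, 2s) to ∂B(x_i, d/3)) < ε₀/n` at
the finitely many special points `x_i` (RSW, Assumption 1.1 (1)).  We prove the variant in which
the modification CLOSES a set `B` of edges drawn near the points `x_i` (the tree's convention for
the squares around the special points): for bond percolation on `δℤ²` drawn in the plane
(`z2QuadConfig`, `openEdgeUnion`) and a quad `Q`,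

* `setOf_mem_z2QuadConfig_symmDiff_sdiff` — by monotonicity the symmetric difference of the two
  crossing events is `{Q ∈ S_ω} ∖ {Q ∈ S_{ω ∖ B}}`;
* `exists_mem_annulusOpenCrossing_of_crossed_of_not_crossed_sdiff` — **deterministic part**: if
  `ω` crosses `Q` but `ω ∖ B` does not, and every edge of `B` is drawn within `s` of some `x_i`,
  then some crossing continuum of `ω` passes within `s + 2δ` of some `x_i`; since it also meets
  both `∂₀Q` and `∂₂Q`, one of which stays at distance `≥ d_i` from `x_i`, the open edges of `ω`
  cross the annulus `A(x_i; s + 3δ, d_i - δ)` (`mem_annulusOpenCrossing_of_isPreconnected'`);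
* `real_crossed_not_crossed_sdiff_le_sum` — hence
  `P(Q ∈ S_ω, Q ∉ S_{ω∖B}) ≤ Σ_i P(A(x_i; s + 3δ, d_i - δ) crossed by open edges)`, and with the
  RSW bound `annulusOpenCrossing_half_le_holds` (critical bond percolation),
  `real_crossed_not_crossed_sdiff_le_sum_rpow`: `≤ Σ_i ((s + 3δ)/(d_i - δ))^α` — Schramm–Smirnov's
  (4.4) with (4.3) made explicit.

## References

* O. Schramm, S. Smirnov, Ann. Probab. 39 (2011) 1768–1814, arXiv:1101.5820, §4, proof of
  Prop. 4.1, (4.3)–(4.4); §2, first paragraph of the proof of Thm. 1.1 (the same excision).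
  [SchrammSmirnov2011]
* G. Grimmett, *Percolation*, 2nd ed. (1999), §11.8 (RSW annulus bounds). [GrimmettPercolation1999]

Tree: `z2QuadConfig`, `z2QuadConfig_mono` (`QuadCrossingSpaceZ2.lean`),
`mem_z2QuadConfig_iff_exists_isCrossing` (`QuadCrossingRawClosed.lean`), `Quad.IsCrossing`
(`QuadCrossingSpace.lean`), `openEdgeUnion`, `mem_openEdgeUnion_iff`
(`QuadCrossingRotationInvariance.lean`), `mem_annulusOpenCrossing_of_isPreconnected'`
(`AnnulusSubcontinuum.lean`), `dist_meshPoint_le_of_mem_segment` (`OpenPathAnnulusCrossing.lean`),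
`annulusOpenCrossing_half_le_holds` (`AnnulusCrossingBoundProofs.lean`).
-/

noncomputable section

open MeasureTheory Set Metric
open scoped symmDiff

namespace Literature.Probability.Percolation

open LatticeModels QuadCrossing

variable {D : Set ℂ}

/-! ### Monotonicity: the symmetric difference is a difference -/

/-- Closing edges can only destroy crossings: `{Q ∈ S_ω} Δ {Q ∈ S_{ω∖B}} = {Q ∈ S_ω} ∖ {Q ∈ S_{ω∖B}}`.
[cite: SchrammSmirnov2011, §1.3 (S_ω is increasing in ω)] -/
theorem setOf_mem_z2QuadConfig_symmDiff_sdiff (δ : ℝ) (Q : Quad D) (B : Set (Sym2 (Site 2))) :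
    {ω : BondConfig (Site 2) | Q ∈ z2QuadConfig D δ ω} ∆ {ω | Q ∈ z2QuadConfig D δ (ω \ B)} =
      {ω | Q ∈ z2QuadConfig D δ ω ∧ Q ∉ z2QuadConfig D δ (ω \ B)} := by
  ext ω
  simp only [Set.mem_symmDiff, mem_setOf_eq]
  constructor
  · rintro (⟨h1, h2⟩ | ⟨h1, h2⟩)
    · exact ⟨h1, h2⟩
    · exact absurd (z2QuadConfig_mono D δ Set.sdiff_subset h1) h2
  · rintro ⟨h1, h2⟩
    exact Or.inl ⟨h1, h2⟩

/-! ### The deterministic part: a destroyed crossing passes near an excised point -/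

/-- A crossing of `Q` inside the open edges of `ω` that is not inside the open edges of `ω ∖ B`
contains a point of a drawn edge of `B`. [folklore] -/
theorem exists_mem_segment_of_subset_openEdgeUnion_of_not_subset {δ : ℝ} {ω : BondConfig (Site 2)}
    {B : Set (Sym2 (Site 2))} {K : Set ℂ} (hK : K ⊆ openEdgeUnion δ ω)
    (hK' : ¬ K ⊆ openEdgeUnion δ (ω \ B)) :
    ∃ p ∈ K, ∃ u v : Site 2, (zdGraph 2).Adj u v ∧ s(u, v) ∈ B ∧ s(u, v) ∈ ω ∧
      p ∈ segment ℝ (meshPoint δ u) (meshPoint δ v) := by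
  obtain ⟨p, hpK, hp⟩ := not_subset.1 hK'
  obtain ⟨u, v, huv, hω, hseg⟩ := mem_openEdgeUnion_iff.1 (hK hpK)
  refine ⟨p, hpK, u, v, huv, ?_, hω, hseg⟩
  by_contra hB
  exact hp (mem_openEdgeUnion_iff.2 ⟨u, v, huv, ⟨hω, hB⟩, hseg⟩)

/-- **Deterministic part of (4.4).**  Let `ω` cross the quad `Q` at mesh `δ > 0` while `ω ∖ B`
does not, where every edge of `B` is drawn within `s` of one of the points `x i` (`i ∈ I`), and
suppose that for each `i` one of the two sides `∂₀Q`, `∂₂Q` stays at distance `≥ d i` from `x i`,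
with `s + 2δ ≤ d i`.  Then for some `i ∈ I` the open edges of `ω` cross the annulus
`A(x i; s + 3δ, d i - δ)`. [cite: SchrammSmirnov2011, §4, proof of Prop. 4.1, (4.3)–(4.4)] -/
theorem exists_mem_annulusOpenCrossing_of_crossed_of_not_crossed_sdiff {δ : ℝ} (hδ : 0 < δ)
    {ω : BondConfig (Site 2)} {Q : Quad D} {B : Set (Sym2 (Site 2))} {ι : Type*} (I : Finset ι)
    {x : ι → ℂ} {s : ℝ} {d : ι → ℝ}
    (hB : ∀ u v : Site 2, (zdGraph 2).Adj u v → s(u, v) ∈ B →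
      ∃ i ∈ I, ∃ z ∈ segment ℝ (meshPoint δ u) (meshPoint δ v), dist z (x i) ≤ s)
    (hd : ∀ i ∈ I, (∀ z ∈ Q.side 0, d i ≤ dist z (x i)) ∨ (∀ z ∈ Q.side 2, d i ≤ dist z (x i)))
    (hsd : ∀ i ∈ I, s + 2 * δ ≤ d i)
    (hcross : Q ∈ z2QuadConfig D δ ω) (hnot : Q ∉ z2QuadConfig D δ (ω \ B)) :
    ∃ i ∈ I, ω ∈ annulusOpenCrossing (x i) δ (s + 2 * δ + δ) (d i - δ) := by
  obtain ⟨K, hKQ, hKO⟩ := (mem_z2QuadConfig_iff_exists_isCrossing hδ).1 hcross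
  have hK' : ¬ K ⊆ openEdgeUnion δ (ω \ B) := fun h =>
    hnot ((mem_z2QuadConfig_iff_exists_isCrossing hδ).2 ⟨K, hKQ, h⟩)
  obtain ⟨p, hpK, u, v, huv, huvB, -, hpseg⟩ :=
    exists_mem_segment_of_subset_openEdgeUnion_of_not_subset hKO hK'
  obtain ⟨i, hi, z, hzseg, hz⟩ := hB u v huv huvB
  obtain ⟨hKc, hKconn, -, ⟨q₀, hq₀K, hq₀⟩, ⟨q₂, hq₂K, hq₂⟩⟩ := hKQ
  -- `p` is within `s + 2δ` of `x i`
  have hp : dist p (x i) ≤ s + 2 * δ := by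
    have h1 : dist (meshPoint δ u) p ≤ δ := dist_meshPoint_le_of_mem_segment hδ huv hpseg
    have h2 : dist (meshPoint δ u) z ≤ δ := dist_meshPoint_le_of_mem_segment hδ huv hzseg
    linarith [dist_triangle p (meshPoint δ u) (x i), dist_triangle (meshPoint δ u) z (x i),
      dist_comm p (meshPoint δ u)]
  refine ⟨i, hi, mem_annulusOpenCrossing_of_isPreconnected' hδ (x i) (hsd i hi) hKc
    hKconn.isPreconnected hKO ⟨p, hpK, hp⟩ ?_⟩
  rcases hd i hi with h | h
  · exact ⟨q₀, hq₀K, h q₀ hq₀⟩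
  · exact ⟨q₂, hq₂K, h q₂ hq₂⟩

/-! ### The probability estimate -/

/-- **(4.4), union-bound form**: `P_p(Q ∈ S_ω, Q ∉ S_{ω∖B}) ≤ Σ_i P_p(A(x_i; s + 3δ, d_i - δ) is
crossed by open edges)`, for every parameter `p`. [cite: SchrammSmirnov2011, §4, proof of Prop. 4.1, (4.4)] -/
theorem real_crossed_not_crossed_sdiff_le_sum (p : unitInterval) {δ : ℝ} (hδ : 0 < δ)
    (Q : Quad D) (B : Set (Sym2 (Site 2))) {ι : Type*} (I : Finset ι) {x : ι → ℂ} {s : ℝ}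
    {d : ι → ℝ}
    (hB : ∀ u v : Site 2, (zdGraph 2).Adj u v → s(u, v) ∈ B →
      ∃ i ∈ I, ∃ z ∈ segment ℝ (meshPoint δ u) (meshPoint δ v), dist z (x i) ≤ s)
    (hd : ∀ i ∈ I, (∀ z ∈ Q.side 0, d i ≤ dist z (x i)) ∨ (∀ z ∈ Q.side 2, d i ≤ dist z (x i)))
    (hsd : ∀ i ∈ I, s + 2 * δ ≤ d i) :
    (bondPercolation (zdGraph 2) p).real
        {ω | Q ∈ z2QuadConfig D δ ω ∧ Q ∉ z2QuadConfig D δ (ω \ B)} ≤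
      ∑ i ∈ I, (bondPercolation (zdGraph 2) p).real (annulusOpenCrossing (x i) δ (s + 2 * δ + δ) (d i - δ)) := by
  refine le_trans (measureReal_mono (fun ω hω => ?_) (measure_ne_top _ _)) (measureReal_biUnion_finset_le I _)
  obtain ⟨i, hi, h⟩ := exists_mem_annulusOpenCrossing_of_crossed_of_not_crossed_sdiff hδ I hB hd hsd hω.1 hω.2
  exact mem_biUnion hi h

/-- **(4.4) for critical bond percolation on `δℤ²`**: with the RSW constants `α, c₀` of
`annulusOpenCrossing_half_le_holds`, if moreover `c₀ δ ≤ s + 3δ` and `2(s + 3δ) ≤ d_i - δ`, then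
`P_{1/2}(Q ∈ S_ω, Q ∉ S_{ω∖B}) ≤ Σ_i ((s + 3δ)/(d_i - δ))^α` — "Clearly, (4.3) implies that if
`η < s`, `P_η({ω ∈ ⊞_{Q₀}} Δ {ω̃ ∈ ⊞_{Q₀}}) ≤ ε₀`". [cite: SchrammSmirnov2011, §4, proof of Prop. 4.1, (4.3)–(4.4)] -/
theorem real_crossed_not_crossed_sdiff_le_sum_rpow :
    ∃ α c₀ : ℝ, 0 < α ∧ 0 < c₀ ∧ ∀ {D : Set ℂ} {δ : ℝ}, 0 < δ → ∀ (Q : Quad D) (B : Set (Sym2 (Site 2)))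
      {ι : Type*} (I : Finset ι) {x : ι → ℂ} {s : ℝ} {d : ι → ℝ},
      (∀ u v : Site 2, (zdGraph 2).Adj u v → s(u, v) ∈ B →
        ∃ i ∈ I, ∃ z ∈ segment ℝ (meshPoint δ u) (meshPoint δ v), dist z (x i) ≤ s) →
      (∀ i ∈ I, (∀ z ∈ Q.side 0, d i ≤ dist z (x i)) ∨ (∀ z ∈ Q.side 2, d i ≤ dist z (x i))) →
      c₀ * δ ≤ s + 2 * δ + δ → (∀ i ∈ I, 2 * (s + 2 * δ + δ) ≤ d i - δ) →
      (bondPercolation (zdGraph 2) half).real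
          {ω | Q ∈ z2QuadConfig D δ ω ∧ Q ∉ z2QuadConfig D δ (ω \ B)} ≤
        ∑ i ∈ I, ((s + 2 * δ + δ) / (d i - δ)) ^ α := by
  obtain ⟨α, c₀, hα, hc₀, hbound⟩ := annulusOpenCrossing_half_le_holds
  refine ⟨α, c₀, hα, hc₀, fun {D δ} hδ Q B ι I x s d hB hd hs hsd => ?_⟩
  have hsd' : ∀ i ∈ I, s + 2 * δ ≤ d i := fun i hi => by
    have := hsd i hi; have := mul_pos hc₀ hδ; linarith
  refine (real_crossed_not_crossed_sdiff_le_sum half hδ Q B I hB hd hsd').trans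
    (Finset.sum_le_sum fun i hi => hbound (x i) δ _ _ hδ hs (hsd i hi))

end Literature.Probability.Percolation

end
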